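import Summits.NavierStokesRegularity.FluidComputer.TubeTablePost24
import HarnessLib

/-!
# Kernel run of the post-ramp box tube, chunks 18 … 23 (bp3 gen 16)

HONEST FRAMING: low prior, high value-of-information experiment on Tao's machine paradigm; NOT a
claim that NS blows up.

Kernel evaluations (`decide +kernel`; no `native_decide`, no extra axioms) of the in-tree tube checker
`runTube` (`P = 60`, 12 Taylor terms, cube `Rt`, read-out `CLt`) on the chunks `cP24 18 … cP24 23`
(= design chunks `cT 42 … cT 47`) of `TubeTablePost24.lean`, each from the recorded boundary
state `sP24 i` to `sP24 (i+1)`.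

[cite: Tao2016AveragedNS, §5.5 Thm 5.3 (5.5)]
-/

namespace Summit.NavierStokesRegularity.FluidComputer

namespace TubeTablePost24

open Literature.Analysis.FluidPDE.FluidComputer Literature.Analysis.FluidPDE.FluidComputer.TubeTable
open Literature.Analysis.FluidPDE.FluidComputer.ThresholdLevelTable (GIt)

set_option maxHeartbeats 10000000 in
set_option maxRecDepth 200000 in
/-- Chunk 18 of the post-ramp tube run (design chunk 42: 50 steps at `h = 2^-11`). [folklore] -/
theorem runP24_18 : runTube 60 12 GIt CLt Rt (sP24 18) (cP24 18) = some (sP24 (18 + 1)) := by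
  decide +kernel

set_option maxHeartbeats 10000000 in
set_option maxRecDepth 200000 in
/-- Chunk 19 of the post-ramp tube run (design chunk 43: 20 steps at `h = 2^-11`). [folklore] -/
theorem runP24_19 : runTube 60 12 GIt CLt Rt (sP24 19) (cP24 19) = some (sP24 (19 + 1)) := by
  decide +kernel

set_option maxHeartbeats 10000000 in
set_option maxRecDepth 200000 in
/-- Chunk 20 of the post-ramp tube run (design chunk 44: 50 steps at `h = 2^-13`). [folklore] -/
theorem runP24_20 : runTube 60 12 GIt CLt Rt (sP24 20) (cP24 20) = some (sP24 (20 + 1)) := by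
  decide +kernel

set_option maxHeartbeats 10000000 in
set_option maxRecDepth 200000 in
/-- Chunk 21 of the post-ramp tube run (design chunk 45: 50 steps at `h = 2^-13`). [folklore] -/
theorem runP24_21 : runTube 60 12 GIt CLt Rt (sP24 21) (cP24 21) = some (sP24 (21 + 1)) := by
  decide +kernel

set_option maxHeartbeats 10000000 in
set_option maxRecDepth 200000 in
/-- Chunk 22 of the post-ramp tube run (design chunk 46: 50 steps at `h = 2^-13`). [folklore] -/
theorem runP24_22 : runTube 60 12 GIt CLt Rt (sP24 22) (cP24 22) = some (sP24 (22 + 1)) := by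
  decide +kernel

set_option maxHeartbeats 10000000 in
set_option maxRecDepth 200000 in
/-- Chunk 23 of the post-ramp tube run (design chunk 47: 33 steps at `h = 2^-13`). [folklore] -/
theorem runP24_23 : runTube 60 12 GIt CLt Rt (sP24 23) (cP24 23) = some (sP24 (23 + 1)) := by
  decide +kernel

end TubeTablePost24

end Summit.NavierStokesRegularity.FluidComputer
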